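import Summits.CriticalPhenomena.PercolationContinuityZ3.Theorems.PercNearOneGluingNoHeavyLowerTailSahiCombTriWStratumG0Gp
import Summits.CriticalPhenomena.PercolationContinuityZ3.Theorems.PercNearOneGluingNoHeavyLowerTailSahiCombTriWCompression

/-!
# `TRI_W(2) ≥ 0` when one family VANISHES at the bottom index and the other is a HALF-CHAIN (`F ∅ = ∅`, `G{a} ⊆ G{b}`) — unconditional

Support file of the one-cut programme (crux `NoHeavyLowerTail`, stmt-CriticalPhenomena-4575; TRI lane of cell `prim-masterthm`; seat prim-lf-1 gen 37,
memo `FROM-prim-lf-1-gen37-ANTINESTED-AND-LOCALITY.md` §0b).  Target `FiveUpSet.TriWIneq` (OPEN for `a ≥ 2`).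

Index square `{∅, {a}, {b}, univ}`, `P` an up-set, `F, G` monotone families of up-sets of a finite cube.  Known strata with a vanishing bottom need a SECOND
condition of the same kind (`F ∅ = G ∅ = ∅`: `triW_nonneg_of_bot_empty`; `F ∅ = ∅ ∧ G univ = ⊤`: `…left_bot_right_top`; `F ∅ = F{c}`: `triW_nonneg_of_bot_eq_atom`).
This file adds the stratum **`F ∅ = ∅` and `G{a} ⊆ G{b}`** (the middle pair of `G` comparable; the middle pair of `F` ARBITRARY — crossed in either direction),
by a two-line LINEARITY argument found by the type-level LP of this seat (kit j161089, restriction `F ∅ = ∅` of the anti-nested scan, 2 atoms):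

* `LatticeFiveUpSet.triWOne_split_left` — linearity of the thin-edge functional in its first pair:
  `triWOne(P;A,A';B,B') = triWOne(P;∅,A;B',B) + triWOne(P;∅,A';B,B')`;
* `FiveUpSet.triW_eq_pairSum` — `triW P F G = triWOne(P;F ∅,F univ;G ∅,G univ) + triWOne(P;F{a},F{b};G{a},G{b})` (the equality behind
  `LatticeFiveUpSet.triW_nonneg_of_pair_nonneg`);
* **`FiveUpSet.triW_nonneg_of_bot_empty_of_halfChain`** — `F ∅ = ∅ ∧ G{a} ⊆ G{b} ⟹ 0 ≤ triW P F G`.  PROOF: with `F'' := F` except `F''{b} := ∅` (monotone because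
  `F ∅ = ∅`), `triW P F G = triW P F'' G + triWOne(P;∅,F{b};G{a},G{b})`; the first term is `≥ 0` by `triW_nonneg_of_bot_eq_atom` (`F'' ∅ = F''{b}`, lf-1 gen 27,
  rank certificate Σ), the second by the five-up-set theorem (`triWOne_nonneg_cube`, nested pairs `∅ ⊆ F{b}`, `G{a} ⊆ G{b}`);
* `FiveUpSet.triW_nonneg_of_halfChain_of_bot_empty` — the mirror `G ∅ = ∅ ∧ F{a} ⊆ F{b}` (`triW_symm`).
It contains the anti-nested configurations with a vanishing bottom (`F ∅ = ∅`, `F{b} ⊆ F{a}`, `G{a} ⊆ G{b}`), which the type-level LP over the older strata could NOT reach.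
HONEST LABEL: one new unconditional stratum of `TriWIneq` at `a = 2` (linearity + two tree theorems); `TriWIneq` remains OPEN. [this work]
-/

namespace Summit.CriticalPhenomena.PercolationContinuityZ3.Theorems

open Finset FiveUpSet

namespace LatticeFiveUpSet

variable {γ : Type} [DecidableEq γ] [Fintype γ]

/-- **Linearity of the thin-edge functional in its first pair**: `triWOne(P;A,A';B,B') = triWOne(P;∅,A;B',B) + triWOne(P;∅,A';B,B')`
(every term of `triWOne` contains exactly one of `A, A', refl A, refl A'`). [this work] -/
theorem triWOne_split_left (P A A' B B' : Finset (Finset γ)) :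
    triWOne (complEquiv γ) P A A' B B' = triWOne (complEquiv γ) P ∅ A B' B + triWOne (complEquiv γ) P ∅ A' B B' := by
  unfold triWOne
  simp only [image_empty, inter_empty, empty_inter, card_empty, Nat.cast_zero]
  ring

end LatticeFiveUpSet

namespace FiveUpSet

open LatticeFiveUpSet

variable {γ : Type} [DecidableEq γ] [Fintype γ]

/-- **The pair-sum equality at `a = 2`**: for an index cube with two atoms `a ≠ b`,
`triW P F G = triWOne(P;F ∅,F univ;G ∅,G univ) + triWOne(P;F{a},F{b};G{a},G{b})` (from `two_mul_triW`; no hypothesis on `P, F, G`). [this work] -/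
theorem triW_eq_pairSum {β : Type} [DecidableEq β] [Fintype β] {a b : β} (hab : a ≠ b) (hu : (univ : Finset β) = {a, b})
    (P : Finset (Finset γ)) (F G : Finset β → Finset (Finset γ)) :
    triW P F G = triWOne (complEquiv γ) P (F ∅) (F univ) (G ∅) (G univ) + triWOne (complEquiv γ) P (F {a}) (F {b}) (G {a}) (G {b}) := by
  set f : Finset β → ℤ := fun x => triWOne (complEquiv γ) P (F x) (F xᶜ) (G x) (G xᶜ) with hf
  have h2 : 2 * triW P F G = ∑ x : Finset β, f x := two_mul_triW P F G
  have hpb : ({b} : Finset β).powerset = {∅, {b}} := by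
    ext t; rw [mem_powerset, subset_singleton_iff, mem_insert, mem_singleton]
  have hia : insert a (∅ : Finset β) = {a} := by ext x; simp
  have hsum : ∑ x : Finset β, f x = f ∅ + f {b} + (f {a} + f {a, b}) := by
    rw [← Finset.powerset_univ, hu, Finset.sum_powerset_insert (by rwa [mem_singleton]), hpb,
      Finset.sum_pair (Finset.singleton_ne_empty b).symm, Finset.sum_pair (Finset.singleton_ne_empty b).symm, hia]
  have cab : ({a} : Finset β)ᶜ = {b} := compl_singleton_eq_of_univ hab hu
  have cba : ({b} : Finset β)ᶜ = {a} := by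
    have hu' : (univ : Finset β) = {b, a} := by rw [hu, pair_comm]
    exact compl_singleton_eq_of_univ hab.symm hu'
  have cuniv : ({a, b} : Finset β) = univ := hu.symm
  have hsym : ∀ A₀ A₁ B₀ B₁ : Finset (Finset γ),
      triWOne (complEquiv γ) P A₁ A₀ B₁ B₀ = triWOne (complEquiv γ) P A₀ A₁ B₀ B₁ := by
    intro A₀ A₁ B₀ B₁; unfold triWOne; ring
  have f0 : f ∅ = triWOne (complEquiv γ) P (F ∅) (F univ) (G ∅) (G univ) := by simp only [hf, compl_empty]
  have f1 : f {a, b} = triWOne (complEquiv γ) P (F ∅) (F univ) (G ∅) (G univ) := by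
    simp only [hf, cuniv, compl_univ]; exact hsym _ _ _ _
  have fa : f {a} = triWOne (complEquiv γ) P (F {a}) (F {b}) (G {a}) (G {b}) := by simp only [hf, cab]
  have fb : f {b} = triWOne (complEquiv γ) P (F {a}) (F {b}) (G {a}) (G {b}) := by
    simp only [hf, cba]; exact hsym _ _ _ _
  rw [hsum, f0, f1, fa, fb] at h2
  linarith

/-- **STRATUM `F ∅ = ∅ ∧ G{a} ⊆ G{b}` of `TRI_W(2) ≥ 0` (unconditional):** index cube with two atoms `a ≠ b`, up-set `P`, monotone families of up-sets `F, G`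
with `F ∅ = ∅` and `G{a} ⊆ G{b}` (the middle pair of `F` is arbitrary): `0 ≤ triW P F G`.  Linearity in the `{b}`-slot of `F` splits `triW P F G` into
`triW P Z G` with `Z := F` except `Z{b} := ∅` (a `bot_eq_atom` configuration: `Z ∅ = ∅ = Z{b}`) plus the nested thin-edge functional
`triWOne(P;∅,F{b};G{a},G{b}) ≥ 0` (five-up-set theorem). [this work] -/
theorem triW_nonneg_of_bot_empty_of_halfChain {β : Type} [DecidableEq β] [Fintype β] {a b : β} (hab : a ≠ b) (hu : (univ : Finset β) = {a, b})
    (P : Finset (Finset γ)) (F G : Finset β → Finset (Finset γ))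
    (hP : IsUpperSet (P : Set (Finset γ))) (hF : ∀ x, IsUpperSet (F x : Set (Finset γ))) (hG : ∀ x, IsUpperSet (G x : Set (Finset γ)))
    (hFm : Monotone F) (hGm : Monotone G) (hF0 : F ∅ = ∅) (hGab : G {a} ⊆ G {b}) :
    0 ≤ triW P F G := by
  have hb0 : ({b} : Finset β) ≠ ∅ := singleton_ne_empty b
  have hba : ({b} : Finset β) ≠ {a} := fun h => hab.symm (singleton_injective h)
  have hbu : ({b} : Finset β) ≠ univ := by
    intro h
    have : a ∈ ({b} : Finset β) := h ▸ mem_univ a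
    exact hab (mem_singleton.1 this)
  -- the modified family: the value at `{b}` replaced by `∅`
  set Z : Finset β → Finset (Finset γ) := fun x => if x = {b} then ∅ else F x with hZ
  have hZ0 : Z ∅ = ∅ := by simp only [hZ, hb0.symm, if_false, hF0]
  have hZa : Z {a} = F {a} := by simp only [hZ, hba.symm, if_false]
  have hZb : Z {b} = ∅ := by simp only [hZ, if_true]
  have hZu : Z univ = F univ := by simp only [hZ, hbu.symm, if_false]
  have hZup : ∀ x, IsUpperSet ((Z x : Finset (Finset γ)) : Set (Finset γ)) := by
    intro x
    by_cases hx : x = {b}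
    · simp only [hZ, hx, if_true]; exact isUpperSet_empty
    · simp only [hZ, hx, if_false]; exact hF x
  have hZm : Monotone Z := by
    intro x y hxy
    by_cases hx : x = {b}
    · simp only [hZ, hx, if_true]; exact empty_subset _
    · by_cases hy : y = {b}
      · have hx0 : x = ∅ := by
          rcases subset_singleton_iff.1 (hy ▸ hxy) with h | h
          · exact h
          · exact absurd h hx
        rw [hx0, hy, hZ0, hZb]
      · simp only [hZ, hx, hy, if_false]; exact hFm hxy
  -- the bot_eq_atom theorem for the modified family (`Z ∅ = Z {b}`)
  have h1 : 0 ≤ triW P Z G :=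
    triW_nonneg_of_bot_eq_atom hab hu P Z G hP hZup hG hZm hGm b (Or.inl (by rw [hZ0, hZb]))
  -- the nested thin-edge remainder
  have h2 : 0 ≤ triWOne (complEquiv γ) P ∅ (F {b}) (G {a}) (G {b}) := by
    have h := triWOne_nonneg_cube γ P ∅ (F {b}) (G {a}) (G {b}) hP
      isUpperSet_empty (hF {b}) (hG {a}) (hG {b}) (empty_subset _) hGab
    have e : (⟨compl, compl, compl_compl, compl_compl⟩ : Finset γ ≃ Finset γ) = complEquiv γ := rfl
    rwa [e] at h
  -- linearity
  rw [triW_eq_pairSum hab hu P F G, triWOne_split_left P (F {a}) (F {b}) (G {a}) (G {b})]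
  rw [triW_eq_pairSum hab hu P Z G, hZ0, hZa, hZb, hZu, triWOne_split_left P (F {a}) ∅ (G {a}) (G {b})] at h1
  have hz : triWOne (complEquiv γ) P ∅ ∅ (G {a}) (G {b}) = 0 := by
    unfold triWOne; simp
  rw [hF0]
  rw [hz] at h1
  linarith

/-- The mirror stratum **`G ∅ = ∅ ∧ F{a} ⊆ F{b}`** (`F`'s middle pair comparable, `G`'s arbitrary): `0 ≤ triW P F G`, by `triW_symm`. [this work] -/
theorem triW_nonneg_of_halfChain_of_bot_empty {β : Type} [DecidableEq β] [Fintype β] {a b : β} (hab : a ≠ b) (hu : (univ : Finset β) = {a, b})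
    (P : Finset (Finset γ)) (F G : Finset β → Finset (Finset γ))
    (hP : IsUpperSet (P : Set (Finset γ))) (hF : ∀ x, IsUpperSet (F x : Set (Finset γ))) (hG : ∀ x, IsUpperSet (G x : Set (Finset γ)))
    (hFm : Monotone F) (hGm : Monotone G) (hG0 : G ∅ = ∅) (hFab : F {a} ⊆ F {b}) :
    0 ≤ triW P F G := by
  rw [triW_symm]
  exact triW_nonneg_of_bot_empty_of_halfChain hab hu P G F hP hG hF hGm hFm hG0 hFab

end FiveUpSet

end Summit.CriticalPhenomena.PercolationContinuityZ3.Theorems
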